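import Summits.QuantumFields.YangMills.Theorems.F4SubCurvatureDoorFibreReductionDisintegration
import Mathlib
import HarnessLib

/-!
# LINE g21-B «fibre dichotomy» (⟨stmt-QuantumFields-23125⟩) — B5 helper: the window kernels are superpositions of the fibre
# transforms, and each `D₄`-symmetry of the window kernels descends to almost every fibre

Helper toward the registered stub B5 `stub_fibreReduction` (`Cruxes/RationalToGeneral/Lines/fibre_dichotomy.lean` :176).  In the abstract
disintegration package of `…FibreReductionDisintegration` (base `η`, fibres `ν_s`; (dis), (fib), (cone)):

* `window_kernel_eq` — if `K_S` is a Laplace–Fourier kernel of the window measure `μ|{massSq ∈ S}` (`IsLF`) that is invariant under the time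
  reflection, then off the mirror `K_S(x) = ∫_{s∈S} lfEval ν_s x dη(s)`;
* `ae_lfEval_invariant_at` — if EVERY measurable window has such a kernel which is moreover invariant under a given `D₄`-isometry `R`
  (this is what the stub S2 «shell separation» delivers), then for every point `x` with `x₀ ≠ 0 ≠ (Rx)₀`:
  `lfEval ν_s (R x) = lfEval ν_s x` for `η`-a.e. `s` (an `η`-integrable function with vanishing integrals over all windows vanishes a.e.).

Mathlib + tree only; no `sorry`; no new definitions.  HONEST LABEL: helper for a registered stub of an OPEN line; B5, S1, S2, ⟨23125⟩, ⟨23035⟩,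
R2d and the Yang–Mills mass gap remain OPEN; no summit is proved by a line.
-/

noncomputable section

open MeasureTheory MeasureTheory.Measure Set Function Filter Topology ProbabilityTheory
open scoped BigOperators ENNReal

namespace Summit.QuantumFields.YangMills.Theorems.F4SubCurvatureDoorFibreReduction

open Summit.QuantumFields.YangMills.Theorems.F4SubCurvatureDoorLaplaceFourierRegistered (E4 E3 timeSpace IsLF)
open Summit.QuantumFields.YangMills.Theorems.F4SubCurvatureDoorFibreDichotomyAxis (spacePart lfEval IsD4Isometry signIso signIso_apply
  isD4Isometry_signIso)
open Summit.QuantumFields.YangMills.Theorems.F4SubCurvatureDoorShellLFAnalytic (massSq IsShellMeasure timeSpace_self lfEval_timeReflection)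

variable {μ : Measure (ℝ × E3)} {η : Measure ℝ} {ν : Kernel ℝ (ℝ × E3)}

/-! ## The fibre transform at a point -/

/-- `lfEval ν x` is the Laplace–Fourier integrand at `t = |x₀|`, `z⃗ = x⃗`. -/
theorem lfEval_eq_integral (ρ : Measure (ℝ × E3)) (x : E4) :
    lfEval ρ x = ∫ p, Real.exp (-(|x 0| * p.1)) * Real.cos (inner ℝ p.2 (spacePart x)) ∂ρ := rfl

/-- The fibre transforms at a point off the mirror are `η`-integrable. -/
theorem integrable_fibre_lfEval [IsSFiniteKernel ν]
    (hdis : ∀ S : Set ℝ, MeasurableSet S → ∀ f : ℝ × E3 → ℝ≥0∞, Measurable f →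
      ∫⁻ p in massSq ⁻¹' S, f p ∂μ = ∫⁻ s in S, ∫⁻ p, f p ∂(ν s) ∂η)
    (hfib : ∀ᵐ s ∂η, ν s {p | massSq p ≠ s} = 0) (hcone : ∀ᵐ s ∂η, ν s {p | p.1 < ‖p.2‖} = 0)
    (hint : ∀ t : ℝ, 0 < t → Integrable (fun p : ℝ × E3 => Real.exp (-(t * p.1))) μ) {x : E4} (hx : x 0 ≠ 0) :
    Integrable (fun s => lfEval (ν s) x) η :=
  integrable_fibre_lf hdis hfib hcone hint (abs_pos.2 hx) (spacePart x)

/-! ## Window kernels are superpositions of fibre transforms -/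

/-- The time reflection `x₀ ↦ −x₀`. -/
theorem timeReflection_apply_zero (x : E4) : (signIso ![false, true, true, true] x) 0 = -x 0 := by
  rw [signIso_apply]
  rfl

/-- **Window kernels off the mirror.**  If `K_S` is a Laplace–Fourier kernel of the window measure `μ|{massSq ∈ S}` that is invariant under
the time reflection, then `K_S(x) = ∫_{s ∈ S} lfEval ν_s x dη(s)` at every `x` with `x₀ ≠ 0`. -/
theorem window_kernel_eq
    (hdis : ∀ S : Set ℝ, MeasurableSet S → ∀ f : ℝ × E3 → ℝ≥0∞, Measurable f →
      ∫⁻ p in massSq ⁻¹' S, f p ∂μ = ∫⁻ s in S, ∫⁻ p, f p ∂(ν s) ∂η)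
    (hfib : ∀ᵐ s ∂η, ν s {p | massSq p ≠ s} = 0) (hcone : ∀ᵐ s ∂η, ν s {p | p.1 < ‖p.2‖} = 0)
    (hint : ∀ t : ℝ, 0 < t → Integrable (fun p : ℝ × E3 => Real.exp (-(t * p.1))) μ)
    {S : Set ℝ} (hS : MeasurableSet S) {KS : E4 → ℝ} (hLF : IsLF KS (μ.restrict (massSq ⁻¹' S)))
    (hrefl : ∀ x : E4, KS (signIso ![false, true, true, true] x) = KS x) {x : E4} (hx : x 0 ≠ 0) :
    KS x = ∫ s in S, lfEval (ν s) x ∂η := by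
  -- positive time first
  have hpos : ∀ y : E4, 0 < y 0 → KS y = ∫ s in S, lfEval (ν s) y ∂η := by
    intro y hy
    have h1 : KS y = ∫ p, Real.exp (-(y 0 * p.1)) * Real.cos (inner ℝ p.2 (spacePart y)) ∂(μ.restrict (massSq ⁻¹' S)) := by
      have := hLF.2.2 (y 0) (spacePart y) hy
      rwa [timeSpace_self] at this
    rw [h1, setIntegral_lf_eq hdis hfib hcone hint hy (spacePart y) hS]
    refine integral_congr_ae (ae_of_all _ fun s => ?_)
    simp only [lfEval_eq_integral, abs_of_pos hy]
  rcases lt_or_gt_of_ne hx with hneg | hposx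
  · -- negative time: reflect
    set y : E4 := signIso ![false, true, true, true] x with hy
    have hy0 : 0 < y 0 := by rw [hy, timeReflection_apply_zero]; linarith
    rw [← hrefl x, hpos y hy0]
    refine integral_congr_ae (ae_of_all _ fun s => ?_)
    simp only [hy, lfEval_timeReflection]
  · exact hpos x hposx

/-! ## Symmetries of the window kernels descend to a.e. fibre -/

/-- **A `D₄`-symmetry of all window kernels holds in almost every fibre** (at a fixed pair of points).  Suppose every measurable window `S`
carries a Laplace–Fourier kernel `K_S` of `μ|{massSq ∈ S}` invariant under the time reflection and under the `D₄`-isometry `R`.  Then for every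
`x` with `x₀ ≠ 0` and `(Rx)₀ ≠ 0`: `lfEval ν_s (R x) = lfEval ν_s x` for `η`-a.e. `s`. -/
theorem ae_lfEval_invariant_at [IsFiniteMeasure η] [IsSFiniteKernel ν]
    (hdis : ∀ S : Set ℝ, MeasurableSet S → ∀ f : ℝ × E3 → ℝ≥0∞, Measurable f →
      ∫⁻ p in massSq ⁻¹' S, f p ∂μ = ∫⁻ s in S, ∫⁻ p, f p ∂(ν s) ∂η)
    (hfib : ∀ᵐ s ∂η, ν s {p | massSq p ≠ s} = 0) (hcone : ∀ᵐ s ∂η, ν s {p | p.1 < ‖p.2‖} = 0)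
    (hint : ∀ t : ℝ, 0 < t → Integrable (fun p : ℝ × E3 => Real.exp (-(t * p.1))) μ)
    (R : E4 ≃ₗᵢ[ℝ] E4)
    (hwin : ∀ S : Set ℝ, MeasurableSet S → ∃ KS : E4 → ℝ, IsLF KS (μ.restrict (massSq ⁻¹' S)) ∧
      (∀ x : E4, KS (signIso ![false, true, true, true] x) = KS x) ∧ (∀ x : E4, KS (R x) = KS x))
    {x : E4} (hx : x 0 ≠ 0) (hRx : (R x) 0 ≠ 0) :
    ∀ᵐ s ∂η, lfEval (ν s) (R x) = lfEval (ν s) x := by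
  have hi1 := integrable_fibre_lfEval hdis hfib hcone hint hRx
  have hi2 := integrable_fibre_lfEval hdis hfib hcone hint hx
  have hzero : ∀ S : Set ℝ, MeasurableSet S → η S < ∞ → ∫ s in S, (lfEval (ν s) (R x) - lfEval (ν s) x) ∂η = 0 := by
    intro S hS _
    obtain ⟨KS, hLF, hrefl, hR⟩ := hwin S hS
    rw [integral_sub hi1.integrableOn hi2.integrableOn, ← window_kernel_eq hdis hfib hcone hint hS hLF hrefl hRx,
      ← window_kernel_eq hdis hfib hcone hint hS hLF hrefl hx, hR x, sub_self]
  have hae := ae_eq_zero_of_forall_setIntegral_eq_of_sigmaFinite ?_ hzero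
  · filter_upwards [hae] with s hs
    simpa [sub_eq_zero] using hs
  · intro S _ _
    exact (hi1.sub hi2).integrableOn

end Summit.QuantumFields.YangMills.Theorems.F4SubCurvatureDoorFibreReduction

end
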